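import Literature.NumberTheory.Automorphic.ArchStableOrbitalSumTorusTransversal   -- ★ FILE C p840722 (F0P3a-p05 (g11)): `mk_archDiagTorus_eq_mk_iff_forall`, `image_univ_…_piFinset`, `injOn_…_piFinset`, definite-place `mk_circleDiagonal_comp_eq_mk_of_def`
import HarnessLib

/-!
# The fibres of the global relabelling map `ρ ↦ ⟦t(z ∘ ρ)⟧` on `G′_∞ = U(diag α)(L⁺ ⊗ ℝ)` are PRODUCTS of the per-place fibres: a sum over ALL relabellings `ρ : W → S_N` is a class sum
# weighted by `∏_w #fibre_w` (Rogawski 1990 §4.1 (4.1.1) p. 39, §8.2 Prop. 8.2.1 p. 118; Borel–Jacquet 1979 §4.1)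

Topic `NumberTheory/Automorphic`; namespace `Literature.NumberTheory.Automorphic.UnitaryGroup`.  THEOREMS ONLY (no definition, no instance, no notation, no named fact, no `sorry`).
Cell `pub/hodgecm-mathlib`, ENGINE T1 (crux H413 = `stmt-HodgeConjecture-24833`); floor-1 preparation, count-neutral, under books rows #88 (ST-∞) ∕ #111 (S-d): road D2′∕ROAD-Sd, brick
**«(J-sgn) SIGNED `Φ^st_∞` AT `γ₀`» FILE E (global fibre product)** (LEAD WORDS T8-34 (A) ∕ T8-44 (C), F0P3a-plan (g9); author F0P3a-p05 (g11)).  BY NAME over ★ FILE C `ArchStableOrbitalSumTorusTransversal`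
(p840722).  USE: the (δ)∕(L-st) heads (F0P3a-p07 (g7)) read the REGULAR formula ★ (j2) `K⁻¹ Σ_{ρ : W → S₃} ∫ a(g t(z∘ρ) g⁻¹)` and take `ψ → 0`; the limit is a sum over ALL `ρ` of terms depending only on
the CLASS `⟦t(z⁰∘ρ)⟧` at the split-singular `z⁰` — this file turns it into a class sum (per-place fibre sizes: ★ FILE D `2p : 2(3−p)` at the singular place, ★ F0P3a-p02
`card_filter_mk_circleDiagonal_eq_factorial` at the regular places, `N!` at a definite place (§2 here)).

WHAT IS PROVED (any `N`, ANY `z`; `W` = complex places; `diag_w u := ⟨circleDiagonal N u, _⟩ ∈ G_w`).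
* §1 **`filter_univ_mk_archDiagTorus_comp_eq_piFinset`** (the fibre over `⟦t(z ∘ r)⟧` IS `Fintype.piFinset` of the per-place fibres — ★ `mk_archDiagTorus_eq_mk_iff_forall`),
  **`card_filter_univ_mk_archDiagTorus_comp_eq_prod`** (`#fibre = ∏_w #fibre_w`), **`sum_univ_mk_archDiagTorus_comp_eq_sum_piFinset`** (for per-place transversals `R`:
  `Σ_{ρ : W → S_N} F(⟦t(z∘ρ)⟧) = Σ_{r ∈ Π_w R w} (∏_w #fibre_w(r_w)) • F(⟦t(z∘r)⟧)`, any additive commutative monoid), and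
  **`sum_univ_mk_archDiagTorus_comp_eq_sum_piFinset_of_const`** (fibres constant `K w` off one place `w₀`: `= Σ_r ((∏_{w≠w₀} K w)·#fibre_{w₀}(r_{w₀})) • F(⟦t(z∘r)⟧)`).
* §2 per place at a DEFINITE place: `card_filter_univ_mk_circleDiagonal_comp_eq_card_perm_of_def` (every fibre is all of `S_N`: `#fibre_w = N!`).
HONEST LABEL: HC_CM is proved only modulo the printed citations until rung 0 closes; this file is finite bookkeeping and pays nothing by itself.

## References
* [Rogawski1990] J. D. Rogawski, *Automorphic Representations of Unitary Groups in Three Variables*, Ann. of Math. Stud. 123 (1990): §4.1 (4.1.1) p. 39, §8.2 Prop. 8.2.1 p. 118,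
  §8.3 p. 122, §14.2 p. 232.
* [BorelJacquet1979] A. Borel, H. Jacquet, *Automorphic forms and automorphic representations*, PSPM 33.1 (1979), §4.1 (`G_∞ = ∏_w G_w`).
-/

set_option autoImplicit false

noncomputable section

open MeasureTheory Matrix Equiv Finset NumberField NumberField.InfinitePlace
open Literature.LinearAlgebra.Matrix Literature.NumberTheory.Rogawski1990
open scoped MatrixGroups ComplexConjugate ComplexOrder

namespace Literature.NumberTheory.Automorphic.UnitaryGroup

/-! ## §1 Fibres are products of per-place fibres; the all-relabellings sum as a weighted transversal sum -/

section Global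

variable (L : Type) [Field L] [NumberField L] [IsCMField L] (N : ℕ) (α : Fin N → L)

open scoped Classical in
/-- **THE FIBRE OF `ρ ↦ ⟦t(z ∘ ρ)⟧` OVER `⟦t(z ∘ r)⟧` IS THE PRODUCT OF THE PER-PLACE FIBRES** (`⟦t z⟧ = ⟦t z′⟧ ↔ ∀ w, ⟦diag z_w⟧ = ⟦diag z′_w⟧`, ★ `mk_archDiagTorus_eq_mk_iff_forall`).
[cite: Rogawski1990, §4.1 (4.1.1) p. 39] [cite: BorelJacquet1979, §4.1] -/
theorem filter_univ_mk_archDiagTorus_comp_eq_piFinset (z : {w : InfinitePlace L // IsComplex w} → Fin N → Circle)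
    (r : {w : InfinitePlace L // IsComplex w} → Perm (Fin N)) :
    (univ.filter fun ρ : {w : InfinitePlace L // IsComplex w} → Perm (Fin N) =>
        ConjClasses.mk (archDiagTorus L N α fun w => z w ∘ ρ w) = ConjClasses.mk (archDiagTorus L N α fun w => z w ∘ r w)) =
      Fintype.piFinset fun w : {w : InfinitePlace L // IsComplex w} => univ.filter fun σ : Perm (Fin N) =>
        ConjClasses.mk (⟨circleDiagonal N (z w ∘ σ), circleDiagonal_mem_archLocal_diagonal L N α w (z w ∘ σ)⟩ : archLocal L N (diagonal α) w) =
          ConjClasses.mk (⟨circleDiagonal N (z w ∘ r w), circleDiagonal_mem_archLocal_diagonal L N α w (z w ∘ r w)⟩ : archLocal L N (diagonal α) w) := by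
  ext ρ
  simp only [Finset.mem_filter, Finset.mem_univ, true_and, Fintype.mem_piFinset]
  exact mk_archDiagTorus_eq_mk_iff_forall L N α (fun w => z w ∘ ρ w) (fun w => z w ∘ r w)

open scoped Classical in
/-- **`#fibre(⟦t(z ∘ r)⟧) = ∏_w #fibre_w(⟦diag(z_w ∘ r_w)⟧)`**. [cite: Rogawski1990, §4.1 (4.1.1) p. 39] [cite: BorelJacquet1979, §4.1] -/
theorem card_filter_univ_mk_archDiagTorus_comp_eq_prod (z : {w : InfinitePlace L // IsComplex w} → Fin N → Circle)
    (r : {w : InfinitePlace L // IsComplex w} → Perm (Fin N)) :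
    (univ.filter fun ρ : {w : InfinitePlace L // IsComplex w} → Perm (Fin N) =>
        ConjClasses.mk (archDiagTorus L N α fun w => z w ∘ ρ w) = ConjClasses.mk (archDiagTorus L N α fun w => z w ∘ r w)).card =
      ∏ w : {w : InfinitePlace L // IsComplex w}, (univ.filter fun σ : Perm (Fin N) =>
        ConjClasses.mk (⟨circleDiagonal N (z w ∘ σ), circleDiagonal_mem_archLocal_diagonal L N α w (z w ∘ σ)⟩ : archLocal L N (diagonal α) w) =
          ConjClasses.mk (⟨circleDiagonal N (z w ∘ r w), circleDiagonal_mem_archLocal_diagonal L N α w (z w ∘ r w)⟩ : archLocal L N (diagonal α) w)).card := by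
  rw [filter_univ_mk_archDiagTorus_comp_eq_piFinset, Fintype.card_piFinset]

open scoped Classical in
/-- **A SUM OVER ALL RELABELLINGS IS A WEIGHTED TRANSVERSAL SUM**: for per-place transversals `R` (meeting every class: `hcov`; injective on classes: `hinj`) and EVERY `F` on the classes of
`G′_∞` with values in an additive commutative monoid, `Σ_{ρ : W → S_N} F(⟦t(z∘ρ)⟧) = Σ_{r ∈ Π_w R w} (∏_w #fibre_w(r_w)) • F(⟦t(z∘r)⟧)` — what turns the `ψ → 0` limit of ★ (j2)'s
`K⁻¹ Σ_ρ` (a sum over all `ρ` of class functions) into a (signed) CLASS sum at the split-singular point; the per-place fibre sizes are ★ FILE D (`2p`, `2(3−p)` at the singular place),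
★ `card_filter_mk_circleDiagonal_eq_factorial` (regular places) and §2 (`N!` at a definite place). [cite: Rogawski1990, §4.1 (4.1.1) p. 39; §8.2 Prop. 8.2.1 p. 118] [cite: BorelJacquet1979, §4.1] -/
theorem sum_univ_mk_archDiagTorus_comp_eq_sum_piFinset {M : Type*} [AddCommMonoid M]
    (z : {w : InfinitePlace L // IsComplex w} → Fin N → Circle) (R : {w : InfinitePlace L // IsComplex w} → Finset (Perm (Fin N)))
    (hcov : ∀ (w : {w : InfinitePlace L // IsComplex w}) (ρ : Perm (Fin N)), ∃ r ∈ R w,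
      ConjClasses.mk (⟨circleDiagonal N (z w ∘ ρ), circleDiagonal_mem_archLocal_diagonal L N α w (z w ∘ ρ)⟩ : archLocal L N (diagonal α) w) =
        ConjClasses.mk (⟨circleDiagonal N (z w ∘ r), circleDiagonal_mem_archLocal_diagonal L N α w (z w ∘ r)⟩ : archLocal L N (diagonal α) w))
    (hinj : ∀ w : {w : InfinitePlace L // IsComplex w}, Set.InjOn (fun r : Perm (Fin N) =>
      ConjClasses.mk (⟨circleDiagonal N (z w ∘ r), circleDiagonal_mem_archLocal_diagonal L N α w (z w ∘ r)⟩ : archLocal L N (diagonal α) w)) ↑(R w))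
    (F : ConjClasses ↥(arch (↥(maximalRealSubfield L)) L (IsCMField.complexConj L) N (diagonal α)) → M) :
    ∑ ρ : {w : InfinitePlace L // IsComplex w} → Perm (Fin N), F (ConjClasses.mk (archDiagTorus L N α fun w => z w ∘ ρ w)) =
      ∑ r ∈ Fintype.piFinset R,
        (∏ w : {w : InfinitePlace L // IsComplex w}, (univ.filter fun σ : Perm (Fin N) =>
          ConjClasses.mk (⟨circleDiagonal N (z w ∘ σ), circleDiagonal_mem_archLocal_diagonal L N α w (z w ∘ σ)⟩ : archLocal L N (diagonal α) w) =
            ConjClasses.mk (⟨circleDiagonal N (z w ∘ r w), circleDiagonal_mem_archLocal_diagonal L N α w (z w ∘ r w)⟩ : archLocal L N (diagonal α) w)).card) •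
          F (ConjClasses.mk (archDiagTorus L N α fun w => z w ∘ r w)) := by
  have himg := image_univ_mk_archDiagTorus_comp_eq_image_piFinset L N α z R hcov
  have hmaps : ∀ ρ ∈ (univ : Finset ({w : InfinitePlace L // IsComplex w} → Perm (Fin N))),
      (fun ρ' : {w : InfinitePlace L // IsComplex w} → Perm (Fin N) => ConjClasses.mk (archDiagTorus L N α fun w => z w ∘ ρ' w)) ρ ∈
        (Fintype.piFinset R).image
          (fun ρ' : {w : InfinitePlace L // IsComplex w} → Perm (Fin N) => ConjClasses.mk (archDiagTorus L N α fun w => z w ∘ ρ' w)) := fun ρ _ => by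
    rw [← himg]
    exact Finset.mem_image_of_mem _ (Finset.mem_univ ρ)
  rw [← Finset.sum_fiberwise_of_maps_to hmaps, Finset.sum_image (injOn_mk_archDiagTorus_comp_piFinset L N α z R hinj)]
  refine Finset.sum_congr rfl fun r _ => ?_
  rw [Finset.sum_congr rfl (fun ρ hρ => congrArg F (Finset.mem_filter.mp hρ).2), Finset.sum_const, card_filter_univ_mk_archDiagTorus_comp_eq_prod]

open scoped Classical in
/-- **CONSTANT FIBRES OFF ONE PLACE**: if at every place `w ≠ w₀` the fibre sizes on the transversal `R w` are a constant `K w` (REGULAR places: `K w = p_w!(N−p_w)!` by ★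
`card_filter_mk_circleDiagonal_eq_factorial`; DEFINITE places: `K w = N!` by §2), then `Σ_{ρ} F(⟦t(z∘ρ)⟧) = Σ_{r ∈ Π_w R w} ((∏_{w ≠ w₀} K w) · #fibre_{w₀}(r_{w₀})) • F(⟦t(z∘r)⟧)` — the shape of the
(δ)∕(L-st) limit at a torus point singular at `w₀` only (★ FILE D supplies `#fibre_{w₀} ∈ {2p, 2(3−p)}`). [cite: Rogawski1990, §8.2 Prop. 8.2.1 p. 118; §4.1 (4.1.1) p. 39] -/
theorem sum_univ_mk_archDiagTorus_comp_eq_sum_piFinset_of_const {M : Type*} [AddCommMonoid M]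
    (z : {w : InfinitePlace L // IsComplex w} → Fin N → Circle) (R : {w : InfinitePlace L // IsComplex w} → Finset (Perm (Fin N)))
    (hcov : ∀ (w : {w : InfinitePlace L // IsComplex w}) (ρ : Perm (Fin N)), ∃ r ∈ R w,
      ConjClasses.mk (⟨circleDiagonal N (z w ∘ ρ), circleDiagonal_mem_archLocal_diagonal L N α w (z w ∘ ρ)⟩ : archLocal L N (diagonal α) w) =
        ConjClasses.mk (⟨circleDiagonal N (z w ∘ r), circleDiagonal_mem_archLocal_diagonal L N α w (z w ∘ r)⟩ : archLocal L N (diagonal α) w))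
    (hinj : ∀ w : {w : InfinitePlace L // IsComplex w}, Set.InjOn (fun r : Perm (Fin N) =>
      ConjClasses.mk (⟨circleDiagonal N (z w ∘ r), circleDiagonal_mem_archLocal_diagonal L N α w (z w ∘ r)⟩ : archLocal L N (diagonal α) w)) ↑(R w))
    (w₀ : {w : InfinitePlace L // IsComplex w}) (K : {w : InfinitePlace L // IsComplex w} → ℕ)
    (hK : ∀ w, w ≠ w₀ → ∀ r ∈ R w, (univ.filter fun σ : Perm (Fin N) =>
      ConjClasses.mk (⟨circleDiagonal N (z w ∘ σ), circleDiagonal_mem_archLocal_diagonal L N α w (z w ∘ σ)⟩ : archLocal L N (diagonal α) w) =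
        ConjClasses.mk (⟨circleDiagonal N (z w ∘ r), circleDiagonal_mem_archLocal_diagonal L N α w (z w ∘ r)⟩ : archLocal L N (diagonal α) w)).card = K w)
    (F : ConjClasses ↥(arch (↥(maximalRealSubfield L)) L (IsCMField.complexConj L) N (diagonal α)) → M) :
    ∑ ρ : {w : InfinitePlace L // IsComplex w} → Perm (Fin N), F (ConjClasses.mk (archDiagTorus L N α fun w => z w ∘ ρ w)) =
      ∑ r ∈ Fintype.piFinset R,
        ((∏ w ∈ univ.erase w₀, K w) * (univ.filter fun σ : Perm (Fin N) =>
          ConjClasses.mk (⟨circleDiagonal N (z w₀ ∘ σ), circleDiagonal_mem_archLocal_diagonal L N α w₀ (z w₀ ∘ σ)⟩ : archLocal L N (diagonal α) w₀) =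
            ConjClasses.mk (⟨circleDiagonal N (z w₀ ∘ r w₀), circleDiagonal_mem_archLocal_diagonal L N α w₀ (z w₀ ∘ r w₀)⟩ : archLocal L N (diagonal α) w₀)).card) •
          F (ConjClasses.mk (archDiagTorus L N α fun w => z w ∘ r w)) := by
  rw [sum_univ_mk_archDiagTorus_comp_eq_sum_piFinset L N α z R hcov hinj F]
  refine Finset.sum_congr rfl fun r hr => ?_
  rw [Fintype.mem_piFinset] at hr
  congr 1
  rw [← Finset.prod_erase_mul _ _ (Finset.mem_univ w₀)]
  congr 1
  exact Finset.prod_congr rfl fun w hw => hK w (Finset.ne_of_mem_erase hw) (r w) (hr w)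

end Global

/-! ## §2 The per-place fibre at a DEFINITE place is all of `S_N` -/

section Definite

variable (L : Type) [Field L] (N : ℕ) (α : Fin N → L) (w : {w : InfinitePlace L // IsComplex w})

open scoped Classical in
/-- **AT A DEFINITE PLACE EVERY FIBRE IS ALL OF `S_N`**: `#{σ ∣ ⟦diag(z ∘ σ)⟧ = ⟦diag(z ∘ r)⟧} = N!` (one class through every torus point, ★ `mk_circleDiagonal_comp_eq_mk_of_def`; Mathlib
`Fintype.card_perm`). [cite: Rogawski1990, §14.2 p. 232] -/
theorem card_filter_univ_mk_circleDiagonal_comp_eq_card_perm_of_def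
    (hdef : ((diagonal α).map w.1.embedding).PosDef ∨ (-(diagonal α).map w.1.embedding).PosDef) (z : Fin N → Circle) (r : Perm (Fin N)) :
    (univ.filter fun σ : Perm (Fin N) =>
        ConjClasses.mk (⟨circleDiagonal N (z ∘ σ), circleDiagonal_mem_archLocal_diagonal L N α w (z ∘ σ)⟩ : archLocal L N (diagonal α) w) =
          ConjClasses.mk (⟨circleDiagonal N (z ∘ r), circleDiagonal_mem_archLocal_diagonal L N α w (z ∘ r)⟩ : archLocal L N (diagonal α) w)).card =
      Nat.factorial N := by
  rw [Finset.filter_true_of_mem (fun σ _ => (mk_circleDiagonal_comp_eq_mk_of_def L N α w hdef z σ).trans (mk_circleDiagonal_comp_eq_mk_of_def L N α w hdef z r).symm),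
    Finset.card_univ, Fintype.card_perm, Fintype.card_fin]

end Definite

end Literature.NumberTheory.Automorphic.UnitaryGroup

end
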